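import Literature.MathematicalPhysics.QuantumLattice.GibbsEnergyEntropyBalance
import HarnessLib

/-!
# The TWO-SECTOR (charged) energy–entropy balance inequality for canonical Gibbs eigen-mixtures:
# canonical chemical potentials at positive temperature

Topic `Literature/MathematicalPhysics/QuantumLattice` (thermal toolkit; companion of
`GibbsEnergyEntropyBalance.lean`). That file proves the linearised Araki–Sewell rows
`0 ≤ Σ_a w_a Re⟨ψ_a, (β·Bᴴ(AB − BA) − s·BᴴB + q·BBᴴ)ψ_a⟩` (`e^{s−1} ≤ q`) for the canonical Gibbs
eigen-mixture `(w_a, ψ_a)` of a Hermitian `A` compressed to an invariant coordinate sector `p`, for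
generators `B` PRESERVING the sector — and records that the canonical state is NOT a KMS state for
sector-changing `B` (on the Hubbard torus: number- or spin-changing generators, the «charged» rows of a
thermal relaxation, are valid for the grand-canonical object only). This file proves what IS true for a
charged generator: if `B` carries the sector `p` into a second invariant sector `p'` (and `Bᴴ` carries
`p'` back into `p`), then with the two compressions' eigen-data `(E_a, ψ_a)`, `(E'_b, ψ'_b)` and
UNNORMALISED Boltzmann weights,

  `0 ≤ Σ_a e^{−βE_a} Re⟨ψ_a, (β·Bᴴ(AB − BA) − s·BᴴB) ψ_a⟩ + q · Σ_b e^{−βE'_b} Re⟨ψ'_b, BBᴴ ψ'_b⟩`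

(`sum_exp_mul_re_expect_twoSector_eeb_nonneg`), i.e. after division by `Z_p = Σ_a e^{−βE_a}`,

  `0 ≤ ρ_p(β·Bᴴ[A,B] − s·BᴴB) + q · (Z_{p'}/Z_p) · ρ_{p'}(BBᴴ)`      (`…canonicalWeight…`)

for the two canonical states `ρ_p`, `ρ_{p'}`. This is EXACTLY the grand-canonical row
`0 ≤ ρ(β·Bᴴ[A − μQ, B] − s·BᴴB + q·BBᴴ)` of a charge-lowering `B` with the chemical potential replaced
by the CANONICAL one, `e^{βμ} = Z_{p'}/Z_p` (`μ = F_p − F_{p'}`, the free-energy cost of the charge that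
`B` removes), and with `BBᴴ` read in the neighbouring sector. Optimising over `s` gives the exact
two-sector EEB inequality `x·log(x / ((Z_{p'}/Z_p)·y')) ≤ β·h` (`x = ρ_p(BᴴB)`, `y' = ρ_{p'}(BBᴴ)`,
`h = Re ρ_p(Bᴴ[A,B])`; `re_expect_mul_log_le_twoSector`), and reading it in both directions brackets the
canonical chemical potential by one moment of each sector:

  `log(x/y') − β·h/x ≤ log(Z_{p'}/Z_p) ≤ log(x/y') + β·g'/y'`,   `g' = Re ρ_{p'}(B[A,Bᴴ])`

(`log_sub_div_le_log_partitionRatio`, `log_partitionRatio_le_log_add_div`). For the Hubbard torus and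
`B = c_{xσ}` both `x = N_σ/|Λ|` and `y' = 1 − (N_σ − 1)/|Λ|` are exact, so the brackets are a-priori
bounds on the canonical chemical potential in terms of one kinetic/double-occupancy moment per sector —
the `T > 0` analogue of the band-edge bounds on `μ±` at `T = 0`.

Proof: in the two eigenbases the functional is `Σ_{a,b} |⟨ψ'_b, B ψ_a⟩|² e^{−βE_a}(x − s + q e^{−x})`,
`x = β(E'_b − E_a)`, termwise `≥ 0` by the tangent inequality `sub_add_mul_exp_neg_nonneg_of_exp_le` of the
companion file — the same computation as there with a RECTANGULAR matrix `C = V'ᴴ B|_{p'←p} V` (§1, two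
abstract blocks; §2, two coordinate sectors of one Hermitian matrix; §3, logarithmic form and brackets).
HONEST SCOPE: exact finite-dimensional inequalities; no thermodynamic limit, no equivalence of ensembles,
no claim that `Z_{p'}/Z_p` converges — it is a number attached to the pair of sectors. Everything is
PROVED; no definition, no named fact, no instance.

## Mathlib / tree search

REUSED: `sub_add_mul_exp_neg_nonneg_of_exp_le`, `mul_apply_eq_zero_off` (`GibbsEnergyEntropyBalance`);
`sectorExtend`, `sectorEigenvector`, `sectorEigenvalue`, `canonicalWeight`, `sectorExtend_apply_val`,
`sectorExtend_apply_of_not` (`TorusSectorGibbsMixture`); Mathlib `Matrix.IsHermitian.eigenvectorUnitary`,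
`mulVec_eigenvectorBasis`, `Matrix.mem_unitaryGroup_iff(')`, `Matrix.conjTranspose_submatrix`,
`Real.add_one_le_exp`, `Real.log_le_sub_one_of_pos`, `Real.exp_log`.
`lean search 'twoSector|two_sector|charged.*eeb|chemical.*Gibbs'`: nothing (2026-08-27); the tree's EEB
rows (`…eeb…`, 6 files) all assume a sector-preserving generator. presearch: corpus hybrid «canonical
ensemble KMS condition charged observable chemical potential free energy difference» → Araki–Moriya
2003 §6 (grand-canonical dKMS only), Bratteli–Robinson II Thm. 5.3.15 / §5.4.2 (gauge-invariant KMS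
states and the chemical potential as the free-energy cost of a charge: Araki–Haag–Kastler–Takesaki);
galaxy «Araki-Sewell|auto-correlation lower bound|canonical chemical potential» (star all): no
finite-volume two-sector statement in print — it is the Araki–Sewell computation done between two
sectors, recorded here for the canonical thermal object of the Hubbard programme.

## References

* H. Araki, G. L. Sewell, *KMS conditions and local thermodynamical stability of quantum lattice
  systems*, Commun. Math. Phys. 52 (1977) 103, Thm. (auto-correlation lower bound).
  [cite: BratteliRobinsonII1997, Thm. 5.3.15]
* H. Araki, R. Haag, D. Kastler, M. Takesaki, *Extension of KMS states and chemical potential*, Commun.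
  Math. Phys. 53 (1977) 97 (the chemical potential of a gauge-invariant KMS state = free-energy cost of a
  unit charge), as presented in Bratteli–Robinson II §5.4.2. [cite: BratteliRobinsonII1997, §5.4.2]
* H. Fawzi, O. Fawzi, S. O. Scalet (2024), Thm. 3.1 (EEB ⟺ KMS; the linearised rows).
  [cite: FawziFawziScalet2024, Thm. 3.1]
* H. Araki, H. Moriya, Rev. Math. Phys. 15 (2003) 93, Def. 6.3 / Thm. 6.4 (dKMS for lattice fermions at
  chemical potential `μ`). [cite: ArakiMoriya2003, Def. 6.3]
-/

noncomputable section

namespace Literature.MathematicalPhysics.QuantumLattice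

open Matrix Finset
open scoped ComplexOrder BigOperators

/-! ### §1 Two abstract blocks: the rectangular Araki–Sewell computation -/

section TwoBlocks

variable {κ κ' : Type*} [Fintype κ] [DecidableEq κ] [Fintype κ'] [DecidableEq κ']

omit [DecidableEq κ] in
/-- A diagonal entry of `Vᴴ X V` is the expectation of `X` in the corresponding column of `V`.
[folklore] -/
private theorem conjTranspose_mul_mul_apply_same' (V X : Matrix κ κ ℂ) (a : κ) :
    (Vᴴ * X * V) a a = star (fun i => V i a) ⬝ᵥ (X *ᵥ fun i => V i a) := by
  rw [Matrix.mul_assoc, Matrix.mul_apply]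
  simp only [conjTranspose_apply, dotProduct, Pi.star_apply, mulVec, Matrix.mul_apply]

/-- **Two-block linearised energy–entropy balance (unnormalised Boltzmann weights).** Let `H`, `H'` be
Hermitian on two index types with Mathlib eigenbases `v_a`, `v'_b` and eigenvalues `E_a`, `E'_b`, let
`C₀ : κ' × κ` be ANY rectangular matrix (a generator carrying block `κ` into block `κ'`), and `β, s, q`
real with `e^{s−1} ≤ q`. Then
`0 ≤ Σ_a e^{−βE_a} Re⟨v_a, (β·C₀ᴴ(H'C₀ − C₀H) − s·C₀ᴴC₀) v_a⟩ + q·Σ_b e^{−βE'_b} Re⟨v'_b, C₀C₀ᴴ v'_b⟩`: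
in the eigenbases the sum is `Σ_{a,b} |(V'ᴴC₀V)_{ba}|² e^{−βE_a}(x − s + q e^{−x})`, `x = β(E'_b − E_a)`.
[cite: FawziFawziScalet2024, Thm. 3.1] [cite: BratteliRobinsonII1997, Thm. 5.3.15] -/
theorem sum_exp_mul_re_expect_twoBlock_eeb_nonneg {H : Matrix κ κ ℂ} (hH : H.IsHermitian)
    {H' : Matrix κ' κ' ℂ} (hH' : H'.IsHermitian) (C₀ : Matrix κ' κ ℂ) (β : ℝ) {s q : ℝ}
    (hq : Real.exp (s - 1) ≤ q) :
    0 ≤ ∑ a, Real.exp (-(β * hH.eigenvalues a)) *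
        (star (fun i => (hH.eigenvectorUnitary : Matrix κ κ ℂ) i a) ⬝ᵥ
          ((((β : ℝ) : ℂ) • (C₀ᴴ * (H' * C₀ - C₀ * H)) - ((s : ℝ) : ℂ) • (C₀ᴴ * C₀)) *ᵥ
            fun i => (hH.eigenvectorUnitary : Matrix κ κ ℂ) i a)).re +
      q * ∑ b, Real.exp (-(β * hH'.eigenvalues b)) *
        (star (fun i => (hH'.eigenvectorUnitary : Matrix κ' κ' ℂ) i b) ⬝ᵥ
          ((C₀ * C₀ᴴ) *ᵥ fun i => (hH'.eigenvectorUnitary : Matrix κ' κ' ℂ) i b)).re := by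
  set V : Matrix κ κ ℂ := (hH.eigenvectorUnitary : Matrix κ κ ℂ) with hV
  set V' : Matrix κ' κ' ℂ := (hH'.eigenvectorUnitary : Matrix κ' κ' ℂ) with hV'
  set E : κ → ℝ := hH.eigenvalues with hE
  set E' : κ' → ℝ := hH'.eigenvalues with hE'
  set X : Matrix κ κ ℂ := (((β : ℝ) : ℂ) • (C₀ᴴ * (H' * C₀ - C₀ * H)) - ((s : ℝ) : ℂ) • (C₀ᴴ * C₀))
    with hX
  -- unitarity of both eigenbases
  have hVV : Vᴴ * V = 1 := by
    have h := Matrix.mem_unitaryGroup_iff'.1 hH.eigenvectorUnitary.2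
    rwa [Matrix.star_eq_conjTranspose] at h
  have hVV' : V * Vᴴ = 1 := by
    have h := Matrix.mem_unitaryGroup_iff.1 hH.eigenvectorUnitary.2
    rwa [Matrix.star_eq_conjTranspose] at h
  have hWW : V'ᴴ * V' = 1 := by
    have h := Matrix.mem_unitaryGroup_iff'.1 hH'.eigenvectorUnitary.2
    rwa [Matrix.star_eq_conjTranspose] at h
  have hWW' : V' * V'ᴴ = 1 := by
    have h := Matrix.mem_unitaryGroup_iff.1 hH'.eigenvectorUnitary.2
    rwa [Matrix.star_eq_conjTranspose] at h
  -- diagonalisations `Vᴴ H V = D`, `V'ᴴ H' V' = D'`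
  set D : Matrix κ κ ℂ := diagonal (fun b => ((E b : ℝ) : ℂ)) with hD
  set D' : Matrix κ' κ' ℂ := diagonal (fun b => ((E' b : ℝ) : ℂ)) with hD'
  have hHV : H * V = V * D := by
    ext i a
    have hcol : (fun b => V b a) = ⇑(hH.eigenvectorBasis a) := funext fun b => by
      rw [hV, Matrix.IsHermitian.eigenvectorUnitary_apply]
    have h := hH.mulVec_eigenvectorBasis a
    rw [← hcol] at h
    have hi := congrFun h i
    simp only [mulVec, dotProduct, Pi.smul_apply] at hi
    rw [hD, mul_diagonal, Matrix.mul_apply, hi, RCLike.real_smul_eq_coe_mul, mul_comm]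
    rfl
  have hHV' : H' * V' = V' * D' := by
    ext i a
    have hcol : (fun b => V' b a) = ⇑(hH'.eigenvectorBasis a) := funext fun b => by
      rw [hV', Matrix.IsHermitian.eigenvectorUnitary_apply]
    have h := hH'.mulVec_eigenvectorBasis a
    rw [← hcol] at h
    have hi := congrFun h i
    simp only [mulVec, dotProduct, Pi.smul_apply] at hi
    rw [hD', mul_diagonal, Matrix.mul_apply, hi, RCLike.real_smul_eq_coe_mul, mul_comm]
    rfl
  have hDV : Vᴴ * H * V = D := by
    rw [Matrix.mul_assoc, hHV, ← Matrix.mul_assoc, hVV, Matrix.one_mul]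
  have hDV' : V'ᴴ * H' * V' = D' := by
    rw [Matrix.mul_assoc, hHV', ← Matrix.mul_assoc, hWW, Matrix.one_mul]
  -- the generator in the two eigenbases
  set C : Matrix κ' κ ℂ := V'ᴴ * C₀ * V with hC
  have hCt : Cᴴ = Vᴴ * C₀ᴴ * V' := by
    rw [hC, conjTranspose_mul, conjTranspose_mul, conjTranspose_conjTranspose, Matrix.mul_assoc]
  have e1 : Vᴴ * (C₀ᴴ * (H' * C₀)) * V = Cᴴ * (D' * C) := by
    calc Vᴴ * (C₀ᴴ * (H' * C₀)) * V
        = Vᴴ * (C₀ᴴ * (V' * V'ᴴ) * (H' * (V' * V'ᴴ) * C₀)) * V := by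
          rw [hWW', Matrix.mul_one, Matrix.mul_one]
      _ = (Vᴴ * C₀ᴴ * V') * ((V'ᴴ * H' * V') * (V'ᴴ * C₀ * V)) := by
          simp only [Matrix.mul_assoc]
      _ = Cᴴ * (D' * C) := by rw [hDV', ← hCt, ← hC]
  have e2 : Vᴴ * (C₀ᴴ * (C₀ * H)) * V = Cᴴ * (C * D) := by
    calc Vᴴ * (C₀ᴴ * (C₀ * H)) * V
        = Vᴴ * (C₀ᴴ * (V' * V'ᴴ) * (C₀ * (V * Vᴴ) * H)) * V := by
          rw [hWW', hVV', Matrix.mul_one, Matrix.mul_one]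
      _ = (Vᴴ * C₀ᴴ * V') * ((V'ᴴ * C₀ * V) * (Vᴴ * H * V)) := by
          simp only [Matrix.mul_assoc]
      _ = Cᴴ * (C * D) := by rw [hDV, ← hCt, ← hC]
  have e3 : Vᴴ * (C₀ᴴ * C₀) * V = Cᴴ * C := by
    calc Vᴴ * (C₀ᴴ * C₀) * V = Vᴴ * (C₀ᴴ * (V' * V'ᴴ) * C₀) * V := by
          rw [hWW', Matrix.mul_one]
      _ = (Vᴴ * C₀ᴴ * V') * (V'ᴴ * C₀ * V) := by simp only [Matrix.mul_assoc]
      _ = Cᴴ * C := by rw [← hCt, ← hC]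
  have e4 : V'ᴴ * (C₀ * C₀ᴴ) * V' = C * Cᴴ := by
    calc V'ᴴ * (C₀ * C₀ᴴ) * V' = V'ᴴ * (C₀ * (V * Vᴴ) * C₀ᴴ) * V' := by
          rw [hVV', Matrix.mul_one]
      _ = (V'ᴴ * C₀ * V) * (Vᴴ * C₀ᴴ * V') := by simp only [Matrix.mul_assoc]
      _ = C * Cᴴ := by rw [← hCt, ← hC]
  have hXV : Vᴴ * X * V = ((β : ℝ) : ℂ) • (Cᴴ * (D' * C) - Cᴴ * (C * D)) - ((s : ℝ) : ℂ) • (Cᴴ * C) := by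
    rw [hX]
    simp only [Matrix.mul_sub, Matrix.sub_mul, Matrix.mul_smul, Matrix.smul_mul, smul_sub, e1, e2, e3]
  -- the diagonal entries of the first block, as real numbers
  have hdiag : ∀ a, (star (fun i => V i a) ⬝ᵥ (X *ᵥ fun i => V i a)).re =
      ∑ b, Complex.normSq (C b a) * (β * (E' b - E a) - s) := by
    intro a
    have t1 : (Cᴴ * (D' * C)) a a = ∑ b, ((Complex.normSq (C b a) * E' b : ℝ) : ℂ) := by
      rw [Matrix.mul_apply]
      refine Finset.sum_congr rfl fun b _ => ?_
      rw [conjTranspose_apply, hD', diagonal_mul, Complex.ofReal_mul, Complex.normSq_eq_conj_mul_self,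
        Complex.star_def]
      ring
    have t2 : (Cᴴ * (C * D)) a a = ∑ b, ((Complex.normSq (C b a) * E a : ℝ) : ℂ) := by
      rw [Matrix.mul_apply]
      refine Finset.sum_congr rfl fun b _ => ?_
      rw [conjTranspose_apply, hD, mul_diagonal, Complex.ofReal_mul, Complex.normSq_eq_conj_mul_self,
        Complex.star_def]
      ring
    have t3 : (Cᴴ * C) a a = ∑ b, ((Complex.normSq (C b a) : ℝ) : ℂ) := by
      rw [Matrix.mul_apply]
      refine Finset.sum_congr rfl fun b _ => ?_
      rw [conjTranspose_apply, Complex.normSq_eq_conj_mul_self, Complex.star_def]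
    rw [← conjTranspose_mul_mul_apply_same', hXV]
    simp only [Matrix.sub_apply, Matrix.smul_apply, smul_eq_mul, t1, t2, t3,
      ← Complex.ofReal_sum, ← Complex.ofReal_sub, ← Complex.ofReal_mul, Complex.ofReal_re]
    rw [← Finset.sum_sub_distrib, Finset.mul_sum, Finset.mul_sum, ← Finset.sum_sub_distrib]
    exact Finset.sum_congr rfl fun b _ => by ring
  -- the diagonal entries of the second block
  have hdiag' : ∀ b, (star (fun i => V' i b) ⬝ᵥ ((C₀ * C₀ᴴ) *ᵥ fun i => V' i b)).re =
      ∑ a, Complex.normSq (C b a) := by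
    intro b
    have t4 : (C * Cᴴ) b b = ∑ a, ((Complex.normSq (C b a) : ℝ) : ℂ) := by
      rw [Matrix.mul_apply]
      refine Finset.sum_congr rfl fun a _ => ?_
      rw [conjTranspose_apply, Complex.star_def, Complex.mul_conj]
    rw [← conjTranspose_mul_mul_apply_same', e4, t4, ← Complex.ofReal_sum, Complex.ofReal_re]
  simp_rw [hdiag, hdiag']
  -- regroup into `Σ_a Σ_b N_{ba} (w_a (x - s) + q w'_b)`
  have hsplit : ∑ a, Real.exp (-(β * E a)) * ∑ b, Complex.normSq (C b a) * (β * (E' b - E a) - s) +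
      q * ∑ b, Real.exp (-(β * E' b)) * ∑ a, Complex.normSq (C b a) =
      ∑ a, ∑ b, Complex.normSq (C b a) *
        (Real.exp (-(β * E a)) * (β * (E' b - E a) - s) + q * Real.exp (-(β * E' b))) := by
    have h1 : ∑ a, Real.exp (-(β * E a)) * ∑ b, Complex.normSq (C b a) * (β * (E' b - E a) - s) =
        ∑ a, ∑ b, Complex.normSq (C b a) * (Real.exp (-(β * E a)) * (β * (E' b - E a) - s)) := by
      refine Finset.sum_congr rfl fun a _ => ?_
      rw [Finset.mul_sum]
      exact Finset.sum_congr rfl fun b _ => by ring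
    have h2 : q * ∑ b, Real.exp (-(β * E' b)) * ∑ a, Complex.normSq (C b a) =
        ∑ a, ∑ b, Complex.normSq (C b a) * (q * Real.exp (-(β * E' b))) := by
      rw [Finset.mul_sum, Finset.sum_comm]
      refine Finset.sum_congr rfl fun b _ => ?_
      rw [Finset.mul_sum, Finset.mul_sum]
      exact Finset.sum_congr rfl fun a _ => by ring
    rw [h1, h2, ← Finset.sum_add_distrib]
    refine Finset.sum_congr rfl fun a _ => ?_
    rw [← Finset.sum_add_distrib]
    exact Finset.sum_congr rfl fun b _ => by ring
  rw [hsplit]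
  refine Finset.sum_nonneg fun a _ => Finset.sum_nonneg fun b _ =>
    mul_nonneg (Complex.normSq_nonneg _) ?_
  have hwb : Real.exp (-(β * E' b)) = Real.exp (-(β * E a)) * Real.exp (-(β * (E' b - E a))) := by
    rw [← Real.exp_add]; ring_nf
  rw [hwb, show Real.exp (-(β * E a)) * (β * (E' b - E a) - s) + q * (Real.exp (-(β * E a)) *
      Real.exp (-(β * (E' b - E a)))) = Real.exp (-(β * E a)) * (β * (E' b - E a) - s +
        q * Real.exp (-(β * (E' b - E a)))) by ring]
  exact mul_nonneg (Real.exp_pos _).le (sub_add_mul_exp_neg_nonneg_of_exp_le hq _)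

end TwoBlocks

/-! ### §2 Two invariant coordinate sectors of one Hermitian matrix -/

section TwoSectors

variable {ι : Type*} [Fintype ι] [DecidableEq ι] (p p' : ι → Prop) [DecidablePred p] [DecidablePred p']

omit [DecidableEq ι] [DecidablePred p'] in
/-- A sum over all coordinates of a function vanishing off the sector is the sum over the sector.
[folklore] -/
private theorem sum_eq_sum_subtype_of_eq_zero_off' (f : ι → ℂ) (hf : ∀ i, ¬ p i → f i = 0) :
    ∑ i, f i = ∑ a : Subtype p, f a.1 := by
  rw [← Finset.sum_subtype (Finset.univ.filter p) (by simp), Finset.sum_filter_of_ne]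
  intro i _ hi
  by_contra h
  exact hi (hf i h)

omit [DecidableEq ι] [DecidablePred p'] in
/-- Expectations in an extended sector vector only see the compression:
`⟨ext φ, X ext φ⟩ = ⟨φ, X|_p φ⟩` for every matrix `X`. [folklore] -/
private theorem star_sectorExtend_dotProduct_mulVec_sectorExtend' (X : Matrix ι ι ℂ)
    (φ : Subtype p → ℂ) :
    star (sectorExtend p φ) ⬝ᵥ (X *ᵥ sectorExtend p φ) =
      star φ ⬝ᵥ (X.submatrix (Subtype.val : Subtype p → ι) Subtype.val *ᵥ φ) := by
  have hext : ∀ a : Subtype p, sectorExtend p φ a.1 = φ a := fun a => by simp [sectorExtend, a.2]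
  have hoff : ∀ i, ¬ p i → sectorExtend p φ i = 0 := fun i hi => by simp [sectorExtend, hi]
  rw [dotProduct, dotProduct, sum_eq_sum_subtype_of_eq_zero_off' p]
  · refine Finset.sum_congr rfl fun a _ => ?_
    rw [Pi.star_apply, Pi.star_apply, hext, mulVec, mulVec, dotProduct, dotProduct,
      sum_eq_sum_subtype_of_eq_zero_off' p]
    · simp only [Matrix.submatrix_apply, hext]
    · intro j hj
      rw [hoff j hj, mul_zero]
  · intro i hi
    rw [Pi.star_apply, hoff i hi, star_zero, zero_mul]

omit [DecidableEq ι] [DecidablePred p] in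
/-- Rectangular compression is multiplicative when the right factor carries the column sector into
the middle sector: `(M N)|_{r←p} = M|_{r←p'} N|_{p'←p}` whenever `N` has no entries from `p` into the
complement of `p'`. [folklore] -/
private theorem submatrix_mul_of_cols_into {κ₀ : Type*} (r : κ₀ → ι) (M N : Matrix ι ι ℂ)
    (hN : ∀ i j, ¬ p' i → p j → N i j = 0) :
    (M * N).submatrix r (Subtype.val : Subtype p → ι) =
      M.submatrix r (Subtype.val : Subtype p' → ι) * N.submatrix (Subtype.val : Subtype p' → ι)
        (Subtype.val : Subtype p → ι) := by
  ext a b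
  rw [Matrix.submatrix_apply, Matrix.mul_apply, Matrix.mul_apply,
    sum_eq_sum_subtype_of_eq_zero_off' p']
  · rfl
  · intro k hk
    rw [hN k b.1 hk b.2, mul_zero]

omit [DecidableEq ι] [DecidablePred p] in
/-- Products carry sectors along: if `N` maps `p` into `p'` and `M` maps `p'` into `p''`, then
`M N` has no entries from `p` into the complement of `p''`. [folklore] -/
private theorem mul_apply_eq_zero_off₂ (p'' : ι → Prop) {M N : Matrix ι ι ℂ}
    (hM : ∀ i j, ¬ p'' i → p' j → M i j = 0) (hN : ∀ i j, ¬ p' i → p j → N i j = 0)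
    (i j : ι) (hi : ¬ p'' i) (hj : p j) : (M * N) i j = 0 := by
  rw [Matrix.mul_apply]
  refine Finset.sum_eq_zero fun k _ => ?_
  by_cases hk : p' k
  · rw [hM i k hi hk, zero_mul]
  · rw [hN k j hk hj, mul_zero]

/-- **Two-sector linearised energy–entropy balance (unnormalised weights).** Let `A` be Hermitian
with two invariant coordinate sectors `p`, `p'` (no entries from either sector into its complement),
`(E_a, ψ_a)` and `(E'_b, ψ'_b)` the eigen-data of the two compressions (`sectorEigenvalue`,
`sectorEigenvector`), and `B` a matrix carrying `p` into `p'` whose adjoint carries `p'` into `p`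
(on the Hubbard torus: a generator of definite charge, `p'` = the image sector). For all real
`β, s, q` with `e^{s−1} ≤ q`:
`0 ≤ Σ_a e^{−βE_a} Re⟨ψ_a, (β·Bᴴ(AB − BA) − s·BᴴB) ψ_a⟩ + q·Σ_b e^{−βE'_b} Re⟨ψ'_b, BBᴴ ψ'_b⟩`.
[cite: FawziFawziScalet2024, Thm. 3.1] [cite: BratteliRobinsonII1997, Thm. 5.3.15] -/
theorem sum_exp_mul_re_expect_twoSector_eeb_nonneg {A : Matrix ι ι ℂ} (hA : A.IsHermitian)
    (hinv : ∀ i j, ¬ p i → p j → A i j = 0) (hinv' : ∀ i j, ¬ p' i → p' j → A i j = 0)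
    {B : Matrix ι ι ℂ} (hB : ∀ i j, ¬ p' i → p j → B i j = 0)
    (hB' : ∀ i j, ¬ p i → p' j → Bᴴ i j = 0) (β : ℝ) {s q : ℝ} (hq : Real.exp (s - 1) ≤ q) :
    0 ≤ ∑ a, Real.exp (-(β * sectorEigenvalue p A hA a)) *
        (star (sectorEigenvector p A hA a) ⬝ᵥ
          ((((β : ℝ) : ℂ) • (Bᴴ * (A * B - B * A)) - ((s : ℝ) : ℂ) • (Bᴴ * B)) *ᵥ
            sectorEigenvector p A hA a)).re +
      q * ∑ b, Real.exp (-(β * sectorEigenvalue p' A hA b)) *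
        (star (sectorEigenvector p' A hA b) ⬝ᵥ ((B * Bᴴ) *ᵥ sectorEigenvector p' A hA b)).re := by
  set hAp := hA.submatrix (Subtype.val : Subtype p → ι) with hApdef
  set hAp' := hA.submatrix (Subtype.val : Subtype p' → ι) with hAp'def
  set Ap : Matrix (Subtype p) (Subtype p) ℂ := A.submatrix (Subtype.val : Subtype p → ι) Subtype.val
    with hApm
  set Ap' : Matrix (Subtype p') (Subtype p') ℂ :=
    A.submatrix (Subtype.val : Subtype p' → ι) Subtype.val with hAp'm
  set Bq : Matrix (Subtype p') (Subtype p) ℂ :=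
    B.submatrix (Subtype.val : Subtype p' → ι) (Subtype.val : Subtype p → ι) with hBq
  -- compressions of the observables
  have hBt : (Bᴴ).submatrix (Subtype.val : Subtype p → ι) (Subtype.val : Subtype p' → ι) = Bqᴴ := by
    rw [hBq, Matrix.conjTranspose_submatrix]
  have hAB : ∀ i j, ¬ p' i → p j → (A * B) i j = 0 := mul_apply_eq_zero_off₂ p p' p' hinv' hB
  have hBA : ∀ i j, ¬ p' i → p j → (B * A) i j = 0 := mul_apply_eq_zero_off₂ p p p' hB hinv
  have c1 : (Bᴴ * (A * B)).submatrix (Subtype.val : Subtype p → ι) Subtype.val = Bqᴴ * (Ap' * Bq) := by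
    rw [submatrix_mul_of_cols_into p p' _ Bᴴ (A * B) hAB, submatrix_mul_of_cols_into p p' _ A B hB, hBt]
  have c2 : (Bᴴ * (B * A)).submatrix (Subtype.val : Subtype p → ι) Subtype.val = Bqᴴ * (Bq * Ap) := by
    rw [submatrix_mul_of_cols_into p p' _ Bᴴ (B * A) hBA, submatrix_mul_of_cols_into p p _ B A hinv, hBt]
  have c3 : (Bᴴ * B).submatrix (Subtype.val : Subtype p → ι) Subtype.val = Bqᴴ * Bq := by
    rw [submatrix_mul_of_cols_into p p' _ Bᴴ B hB, hBt]
  have c4 : (B * Bᴴ).submatrix (Subtype.val : Subtype p' → ι) Subtype.val = Bq * Bqᴴ := by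
    rw [submatrix_mul_of_cols_into p' p _ B Bᴴ hB', hBt]
  have hsub : ((((β : ℝ) : ℂ) • (Bᴴ * (A * B - B * A)) - ((s : ℝ) : ℂ) • (Bᴴ * B))).submatrix
        (Subtype.val : Subtype p → ι) Subtype.val =
      (((β : ℝ) : ℂ) • (Bqᴴ * (Ap' * Bq - Bq * Ap)) - ((s : ℝ) : ℂ) • (Bqᴴ * Bq)) := by
    rw [Matrix.mul_sub, Matrix.mul_sub]
    simp only [Matrix.submatrix_sub, Matrix.submatrix_smul, Pi.sub_apply, Pi.smul_apply, c1, c2, c3]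
  -- each term is the corresponding two-block term of the compressions
  have hterm : ∀ a : Subtype p,
      star (sectorEigenvector p A hA a) ⬝ᵥ
        ((((β : ℝ) : ℂ) • (Bᴴ * (A * B - B * A)) - ((s : ℝ) : ℂ) • (Bᴴ * B)) *ᵥ
          sectorEigenvector p A hA a) =
      star (fun b => (hAp.eigenvectorUnitary : Matrix (Subtype p) (Subtype p) ℂ) b a) ⬝ᵥ
        ((((β : ℝ) : ℂ) • (Bqᴴ * (Ap' * Bq - Bq * Ap)) - ((s : ℝ) : ℂ) • (Bqᴴ * Bq)) *ᵥ
          fun b => (hAp.eigenvectorUnitary : Matrix (Subtype p) (Subtype p) ℂ) b a) := by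
    intro a
    rw [sectorEigenvector, star_sectorExtend_dotProduct_mulVec_sectorExtend', hsub]
  have hterm' : ∀ b : Subtype p',
      star (sectorEigenvector p' A hA b) ⬝ᵥ ((B * Bᴴ) *ᵥ sectorEigenvector p' A hA b) =
      star (fun c => (hAp'.eigenvectorUnitary : Matrix (Subtype p') (Subtype p') ℂ) c b) ⬝ᵥ
        ((Bq * Bqᴴ) *ᵥ fun c => (hAp'.eigenvectorUnitary : Matrix (Subtype p') (Subtype p') ℂ) c b) := by
    intro b
    rw [sectorEigenvector, star_sectorExtend_dotProduct_mulVec_sectorExtend', c4]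
  have hE : ∀ a : Subtype p, sectorEigenvalue p A hA a = hAp.eigenvalues a := fun a => rfl
  have hE' : ∀ b : Subtype p', sectorEigenvalue p' A hA b = hAp'.eigenvalues b := fun b => rfl
  simp_rw [hterm, hterm', hE, hE']
  exact sum_exp_mul_re_expect_twoBlock_eeb_nonneg hAp hAp' Bq β hq

/-- The separated form of the two-sector inequality: with the three moments
`h = Σ_a e^{−βE_a} Re⟨ψ_a, Bᴴ(AB − BA)ψ_a⟩`, `x = Σ_a e^{−βE_a} Re⟨ψ_a, BᴴBψ_a⟩`,
`y' = Σ_b e^{−βE'_b} Re⟨ψ'_b, BBᴴψ'_b⟩` (unnormalised), `0 ≤ β·h − s·x + q·y'` whenever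
`e^{s−1} ≤ q`. [cite: FawziFawziScalet2024, Thm. 3.1] -/
theorem sub_add_nonneg_of_twoSector_eeb {A : Matrix ι ι ℂ} (hA : A.IsHermitian)
    (hinv : ∀ i j, ¬ p i → p j → A i j = 0) (hinv' : ∀ i j, ¬ p' i → p' j → A i j = 0)
    {B : Matrix ι ι ℂ} (hB : ∀ i j, ¬ p' i → p j → B i j = 0)
    (hB' : ∀ i j, ¬ p i → p' j → Bᴴ i j = 0) (β : ℝ) {s q : ℝ} (hq : Real.exp (s - 1) ≤ q) :
    0 ≤ β * ∑ a, Real.exp (-(β * sectorEigenvalue p A hA a)) *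
          (star (sectorEigenvector p A hA a) ⬝ᵥ ((Bᴴ * (A * B - B * A)) *ᵥ sectorEigenvector p A hA a)).re -
        s * ∑ a, Real.exp (-(β * sectorEigenvalue p A hA a)) *
          (star (sectorEigenvector p A hA a) ⬝ᵥ ((Bᴴ * B) *ᵥ sectorEigenvector p A hA a)).re +
        q * ∑ b, Real.exp (-(β * sectorEigenvalue p' A hA b)) *
          (star (sectorEigenvector p' A hA b) ⬝ᵥ ((B * Bᴴ) *ᵥ sectorEigenvector p' A hA b)).re := by
  have h := sum_exp_mul_re_expect_twoSector_eeb_nonneg p p' hA hinv hinv' hB hB' β hq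
  have hlin : ∀ a : Subtype p,
      (star (sectorEigenvector p A hA a) ⬝ᵥ
        ((((β : ℝ) : ℂ) • (Bᴴ * (A * B - B * A)) - ((s : ℝ) : ℂ) • (Bᴴ * B)) *ᵥ
          sectorEigenvector p A hA a)).re =
      β * (star (sectorEigenvector p A hA a) ⬝ᵥ ((Bᴴ * (A * B - B * A)) *ᵥ sectorEigenvector p A hA a)).re -
        s * (star (sectorEigenvector p A hA a) ⬝ᵥ ((Bᴴ * B) *ᵥ sectorEigenvector p A hA a)).re := by
    intro a
    rw [sub_mulVec, smul_mulVec, smul_mulVec, dotProduct_sub, dotProduct_smul,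
      dotProduct_smul, Complex.sub_re, smul_eq_mul, smul_eq_mul, Complex.re_ofReal_mul,
      Complex.re_ofReal_mul]
  simp_rw [hlin] at h
  have hsum : ∑ a, Real.exp (-(β * sectorEigenvalue p A hA a)) *
      (β * (star (sectorEigenvector p A hA a) ⬝ᵥ ((Bᴴ * (A * B - B * A)) *ᵥ sectorEigenvector p A hA a)).re -
        s * (star (sectorEigenvector p A hA a) ⬝ᵥ ((Bᴴ * B) *ᵥ sectorEigenvector p A hA a)).re) =
      β * ∑ a, Real.exp (-(β * sectorEigenvalue p A hA a)) *
          (star (sectorEigenvector p A hA a) ⬝ᵥ ((Bᴴ * (A * B - B * A)) *ᵥ sectorEigenvector p A hA a)).re -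
        s * ∑ a, Real.exp (-(β * sectorEigenvalue p A hA a)) *
          (star (sectorEigenvector p A hA a) ⬝ᵥ ((Bᴴ * B) *ᵥ sectorEigenvector p A hA a)).re := by
    rw [Finset.mul_sum, Finset.mul_sum, ← Finset.sum_sub_distrib]
    exact Finset.sum_congr rfl fun a _ => by ring
  linarith [hsum]

/-- **Two-sector energy–entropy balance for the two canonical states (normalised).** With canonical
weights `w_a = e^{−βE_a}/Z_p`, `w'_b = e^{−βE'_b}/Z_{p'}` (`canonicalWeight`) and the partition-function
ratio `Z_{p'}/Z_p = (Σ_b e^{−βE'_b})/(Σ_a e^{−βE_a})` — the exponential `e^{β(F_p − F_{p'})}` of the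
CANONICAL chemical potential of the charge `B` removes — the inequality reads, for `e^{s−1} ≤ q`,
`0 ≤ Σ_a w_a Re⟨ψ_a, (β·Bᴴ(AB − BA) − s·BᴴB) ψ_a⟩ + q·(Z_{p'}/Z_p)·Σ_b w'_b Re⟨ψ'_b, BBᴴ ψ'_b⟩`:
the grand-canonical linearised EEB row of a charged generator with `μ` replaced by the canonical
chemical potential and `BBᴴ` read in the image sector. [cite: BratteliRobinsonII1997, §5.4.2]
[cite: FawziFawziScalet2024, Thm. 3.1] -/
theorem sum_canonicalWeight_mul_re_expect_twoSector_eeb_nonneg {A : Matrix ι ι ℂ} (hA : A.IsHermitian)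
    (hinv : ∀ i j, ¬ p i → p j → A i j = 0) (hinv' : ∀ i j, ¬ p' i → p' j → A i j = 0)
    {B : Matrix ι ι ℂ} (hB : ∀ i j, ¬ p' i → p j → B i j = 0)
    (hB' : ∀ i j, ¬ p i → p' j → Bᴴ i j = 0) (β : ℝ) {s q : ℝ} (hq : Real.exp (s - 1) ≤ q) :
    0 ≤ ∑ a, canonicalWeight β (sectorEigenvalue p A hA) a *
        (star (sectorEigenvector p A hA a) ⬝ᵥ
          ((((β : ℝ) : ℂ) • (Bᴴ * (A * B - B * A)) - ((s : ℝ) : ℂ) • (Bᴴ * B)) *ᵥ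
            sectorEigenvector p A hA a)).re +
      q * ((∑ b, Real.exp (-(β * sectorEigenvalue p' A hA b))) /
            ∑ a, Real.exp (-(β * sectorEigenvalue p A hA a))) *
        ∑ b, canonicalWeight β (sectorEigenvalue p' A hA) b *
          (star (sectorEigenvector p' A hA b) ⬝ᵥ ((B * Bᴴ) *ᵥ sectorEigenvector p' A hA b)).re := by
  have h := sum_exp_mul_re_expect_twoSector_eeb_nonneg p p' hA hinv hinv' hB hB' β hq
  set Z := ∑ a, Real.exp (-(β * sectorEigenvalue p A hA a)) with hZ
  set Z' := ∑ b, Real.exp (-(β * sectorEigenvalue p' A hA b)) with hZ'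
  have hZ0 : 0 ≤ Z := Finset.sum_nonneg fun _ _ => (Real.exp_pos _).le
  have hw : ∀ a, canonicalWeight β (sectorEigenvalue p A hA) a =
      Z⁻¹ * Real.exp (-(β * sectorEigenvalue p A hA a)) := fun a => rfl
  have hw' : ∀ b, canonicalWeight β (sectorEigenvalue p' A hA) b =
      Z'⁻¹ * Real.exp (-(β * sectorEigenvalue p' A hA b)) := fun b => rfl
  simp_rw [hw, hw', mul_assoc, ← Finset.mul_sum]
  rcases isEmpty_or_nonempty (Subtype p') with he | hne
  · -- no image sector: the second term vanishes on both sides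
    have h0 : Z' = 0 := by rw [hZ']; exact Finset.sum_of_isEmpty _
    have h0' : ∑ b : Subtype p', Real.exp (-(β * sectorEigenvalue p' A hA b)) *
        (star (sectorEigenvector p' A hA b) ⬝ᵥ ((B * Bᴴ) *ᵥ sectorEigenvector p' A hA b)).re = 0 :=
      Finset.sum_of_isEmpty _
    rw [h0', mul_zero, add_zero] at h
    rw [h0', mul_zero, mul_zero, mul_zero, add_zero]
    exact mul_nonneg (inv_nonneg.2 hZ0) h
  · have hZ'pos : 0 < Z' := Finset.sum_pos (fun _ _ => Real.exp_pos _) Finset.univ_nonempty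
    have hcancel : Z' / Z * (Z'⁻¹ * ∑ b : Subtype p', Real.exp (-(β * sectorEigenvalue p' A hA b)) *
        (star (sectorEigenvector p' A hA b) ⬝ᵥ ((B * Bᴴ) *ᵥ sectorEigenvector p' A hA b)).re) =
        Z⁻¹ * ∑ b : Subtype p', Real.exp (-(β * sectorEigenvalue p' A hA b)) *
          (star (sectorEigenvector p' A hA b) ⬝ᵥ ((B * Bᴴ) *ᵥ sectorEigenvector p' A hA b)).re := by
      calc Z' / Z * (Z'⁻¹ * ∑ b : Subtype p', Real.exp (-(β * sectorEigenvalue p' A hA b)) *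
            (star (sectorEigenvector p' A hA b) ⬝ᵥ ((B * Bᴴ) *ᵥ sectorEigenvector p' A hA b)).re)
          = (Z' * Z'⁻¹) * (Z⁻¹ * ∑ b : Subtype p', Real.exp (-(β * sectorEigenvalue p' A hA b)) *
            (star (sectorEigenvector p' A hA b) ⬝ᵥ ((B * Bᴴ) *ᵥ sectorEigenvector p' A hA b)).re) := by
            ring
        _ = Z⁻¹ * ∑ b : Subtype p', Real.exp (-(β * sectorEigenvalue p' A hA b)) *
            (star (sectorEigenvector p' A hA b) ⬝ᵥ ((B * Bᴴ) *ᵥ sectorEigenvector p' A hA b)).re := by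
            rw [mul_inv_cancel₀ hZ'pos.ne', one_mul]
    rw [hcancel]
    have hfac := mul_nonneg (inv_nonneg.2 hZ0) h
    rw [mul_add] at hfac
    linarith

/-! ### §3 The exact two-sector inequality and the brackets on the canonical chemical potential -/

/-- **The exact two-sector energy–entropy balance inequality.** In the notation of
`sum_canonicalWeight_mul_re_expect_twoSector_eeb_nonneg`, with `x = Σ_a w_a Re⟨ψ_a, BᴴBψ_a⟩ > 0`,
`y' = Σ_b w'_b Re⟨ψ'_b, BBᴴψ'_b⟩ > 0`, `h = Σ_a w_a Re⟨ψ_a, Bᴴ(AB − BA)ψ_a⟩` and `r = Z_{p'}/Z_p`: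
`x · log(x / (r · y')) ≤ β · h` — the Araki–Sewell function between two sectors (optimise the linear
rows at `s = 1 + log(x/(r y'))`). [cite: BratteliRobinsonII1997, Thm. 5.3.15]
[cite: FawziFawziScalet2024, Thm. 3.1] -/
theorem mul_log_le_of_twoSector_eeb {A : Matrix ι ι ℂ} (hA : A.IsHermitian)
    (hinv : ∀ i j, ¬ p i → p j → A i j = 0) (hinv' : ∀ i j, ¬ p' i → p' j → A i j = 0)
    {B : Matrix ι ι ℂ} (hB : ∀ i j, ¬ p' i → p j → B i j = 0)
    (hB' : ∀ i j, ¬ p i → p' j → Bᴴ i j = 0) (β : ℝ)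
    (hx : 0 < ∑ a, canonicalWeight β (sectorEigenvalue p A hA) a *
      (star (sectorEigenvector p A hA a) ⬝ᵥ ((Bᴴ * B) *ᵥ sectorEigenvector p A hA a)).re)
    (hy : 0 < ∑ b, canonicalWeight β (sectorEigenvalue p' A hA) b *
      (star (sectorEigenvector p' A hA b) ⬝ᵥ ((B * Bᴴ) *ᵥ sectorEigenvector p' A hA b)).re) :
    (∑ a, canonicalWeight β (sectorEigenvalue p A hA) a *
        (star (sectorEigenvector p A hA a) ⬝ᵥ ((Bᴴ * B) *ᵥ sectorEigenvector p A hA a)).re) *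
      Real.log ((∑ a, canonicalWeight β (sectorEigenvalue p A hA) a *
          (star (sectorEigenvector p A hA a) ⬝ᵥ ((Bᴴ * B) *ᵥ sectorEigenvector p A hA a)).re) /
        (((∑ b, Real.exp (-(β * sectorEigenvalue p' A hA b))) /
            ∑ a, Real.exp (-(β * sectorEigenvalue p A hA a))) *
          ∑ b, canonicalWeight β (sectorEigenvalue p' A hA) b *
            (star (sectorEigenvector p' A hA b) ⬝ᵥ ((B * Bᴴ) *ᵥ sectorEigenvector p' A hA b)).re)) ≤
      β * ∑ a, canonicalWeight β (sectorEigenvalue p A hA) a *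
        (star (sectorEigenvector p A hA a) ⬝ᵥ ((Bᴴ * (A * B - B * A)) *ᵥ sectorEigenvector p A hA a)).re := by
  -- abbreviations
  set x := ∑ a, canonicalWeight β (sectorEigenvalue p A hA) a *
      (star (sectorEigenvector p A hA a) ⬝ᵥ ((Bᴴ * B) *ᵥ sectorEigenvector p A hA a)).re with hxdef
  set y := ∑ b, canonicalWeight β (sectorEigenvalue p' A hA) b *
      (star (sectorEigenvector p' A hA b) ⬝ᵥ ((B * Bᴴ) *ᵥ sectorEigenvector p' A hA b)).re with hydef
  set hh := ∑ a, canonicalWeight β (sectorEigenvalue p A hA) a *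
      (star (sectorEigenvector p A hA a) ⬝ᵥ ((Bᴴ * (A * B - B * A)) *ᵥ sectorEigenvector p A hA a)).re
    with hhdef
  set r := (∑ b, Real.exp (-(β * sectorEigenvalue p' A hA b))) /
      ∑ a, Real.exp (-(β * sectorEigenvalue p A hA a)) with hrdef
  -- `r > 0`: `p'` is nonempty since `y > 0`, `p` is nonempty since `x > 0`
  have hne' : Nonempty (Subtype p') := by
    by_contra hc
    rw [not_nonempty_iff] at hc
    rw [hydef, Finset.sum_of_isEmpty] at hy
    exact lt_irrefl _ hy
  have hne : Nonempty (Subtype p) := by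
    by_contra hc
    rw [not_nonempty_iff] at hc
    rw [hxdef, Finset.sum_of_isEmpty] at hx
    exact lt_irrefl _ hx
  have hr : 0 < r := div_pos (Finset.sum_pos (fun _ _ => Real.exp_pos _) Finset.univ_nonempty)
    (Finset.sum_pos (fun _ _ => Real.exp_pos _) Finset.univ_nonempty)
  -- the linear row at the optimal slope
  set s := 1 + Real.log (x / (r * y)) with hsdef
  have hq : Real.exp (s - 1) ≤ x / (r * y) := by
    rw [hsdef, add_sub_cancel_left, Real.exp_log (div_pos hx (mul_pos hr hy))]
  have hrow := sum_canonicalWeight_mul_re_expect_twoSector_eeb_nonneg p p' hA hinv hinv' hB hB' β hq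
  have hlin : ∀ a : Subtype p,
      (star (sectorEigenvector p A hA a) ⬝ᵥ
        ((((β : ℝ) : ℂ) • (Bᴴ * (A * B - B * A)) - ((s : ℝ) : ℂ) • (Bᴴ * B)) *ᵥ
          sectorEigenvector p A hA a)).re =
      β * (star (sectorEigenvector p A hA a) ⬝ᵥ ((Bᴴ * (A * B - B * A)) *ᵥ sectorEigenvector p A hA a)).re -
        s * (star (sectorEigenvector p A hA a) ⬝ᵥ ((Bᴴ * B) *ᵥ sectorEigenvector p A hA a)).re := by
    intro a
    rw [sub_mulVec, smul_mulVec, smul_mulVec, dotProduct_sub, dotProduct_smul,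
      dotProduct_smul, Complex.sub_re, smul_eq_mul, smul_eq_mul, Complex.re_ofReal_mul,
      Complex.re_ofReal_mul]
  simp_rw [hlin] at hrow
  have hsum : ∑ a, canonicalWeight β (sectorEigenvalue p A hA) a *
      (β * (star (sectorEigenvector p A hA a) ⬝ᵥ ((Bᴴ * (A * B - B * A)) *ᵥ sectorEigenvector p A hA a)).re -
        s * (star (sectorEigenvector p A hA a) ⬝ᵥ ((Bᴴ * B) *ᵥ sectorEigenvector p A hA a)).re) =
      β * hh - s * x := by
    rw [hhdef, hxdef, Finset.mul_sum, Finset.mul_sum, ← Finset.sum_sub_distrib]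
    exact Finset.sum_congr rfl fun a _ => by ring
  rw [hsum, ← hrdef, ← hydef] at hrow
  -- `q r y = x`, so `0 ≤ β h − (1 + log(x/(r y))) x + x`
  have hqry : x / (r * y) * r * y = x := by
    field_simp
  have : s * x = x + x * Real.log (x / (r * y)) := by rw [hsdef]; ring
  nlinarith [hrow, hqry, this]

/-- **Lower bracket on the canonical chemical potential.** In the same notation (`x, y' > 0`):
`log(x/y') − β·h/x ≤ log(Z_{p'}/Z_p)` — from `x log(x/(r y')) ≤ βh`. For a single annihilator on the
Hubbard torus `x` and `y'` are exact densities and `h` is a kinetic/double-occupancy moment of the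
sector `p`. [cite: BratteliRobinsonII1997, §5.4.2] [cite: FawziFawziScalet2024, Thm. 3.1] -/
theorem log_div_sub_div_le_log_partitionRatio {A : Matrix ι ι ℂ} (hA : A.IsHermitian)
    (hinv : ∀ i j, ¬ p i → p j → A i j = 0) (hinv' : ∀ i j, ¬ p' i → p' j → A i j = 0)
    {B : Matrix ι ι ℂ} (hB : ∀ i j, ¬ p' i → p j → B i j = 0)
    (hB' : ∀ i j, ¬ p i → p' j → Bᴴ i j = 0) (β : ℝ)
    (hx : 0 < ∑ a, canonicalWeight β (sectorEigenvalue p A hA) a *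
      (star (sectorEigenvector p A hA a) ⬝ᵥ ((Bᴴ * B) *ᵥ sectorEigenvector p A hA a)).re)
    (hy : 0 < ∑ b, canonicalWeight β (sectorEigenvalue p' A hA) b *
      (star (sectorEigenvector p' A hA b) ⬝ᵥ ((B * Bᴴ) *ᵥ sectorEigenvector p' A hA b)).re) :
    Real.log ((∑ a, canonicalWeight β (sectorEigenvalue p A hA) a *
          (star (sectorEigenvector p A hA a) ⬝ᵥ ((Bᴴ * B) *ᵥ sectorEigenvector p A hA a)).re) /
        ∑ b, canonicalWeight β (sectorEigenvalue p' A hA) b *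
          (star (sectorEigenvector p' A hA b) ⬝ᵥ ((B * Bᴴ) *ᵥ sectorEigenvector p' A hA b)).re) -
      β * (∑ a, canonicalWeight β (sectorEigenvalue p A hA) a *
          (star (sectorEigenvector p A hA a) ⬝ᵥ ((Bᴴ * (A * B - B * A)) *ᵥ sectorEigenvector p A hA a)).re) /
        (∑ a, canonicalWeight β (sectorEigenvalue p A hA) a *
          (star (sectorEigenvector p A hA a) ⬝ᵥ ((Bᴴ * B) *ᵥ sectorEigenvector p A hA a)).re) ≤
      Real.log ((∑ b, Real.exp (-(β * sectorEigenvalue p' A hA b))) /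
        ∑ a, Real.exp (-(β * sectorEigenvalue p A hA a))) := by
  set x := ∑ a, canonicalWeight β (sectorEigenvalue p A hA) a *
      (star (sectorEigenvector p A hA a) ⬝ᵥ ((Bᴴ * B) *ᵥ sectorEigenvector p A hA a)).re with hxdef
  set y := ∑ b, canonicalWeight β (sectorEigenvalue p' A hA) b *
      (star (sectorEigenvector p' A hA b) ⬝ᵥ ((B * Bᴴ) *ᵥ sectorEigenvector p' A hA b)).re with hydef
  set hh := ∑ a, canonicalWeight β (sectorEigenvalue p A hA) a *
      (star (sectorEigenvector p A hA a) ⬝ᵥ ((Bᴴ * (A * B - B * A)) *ᵥ sectorEigenvector p A hA a)).re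
    with hhdef
  set r := (∑ b, Real.exp (-(β * sectorEigenvalue p' A hA b))) /
      ∑ a, Real.exp (-(β * sectorEigenvalue p A hA a)) with hrdef
  have hne' : Nonempty (Subtype p') := by
    by_contra hc
    rw [not_nonempty_iff] at hc
    rw [hydef, Finset.sum_of_isEmpty] at hy
    exact lt_irrefl _ hy
  have hne : Nonempty (Subtype p) := by
    by_contra hc
    rw [not_nonempty_iff] at hc
    rw [hxdef, Finset.sum_of_isEmpty] at hx
    exact lt_irrefl _ hx
  have hr : 0 < r := div_pos (Finset.sum_pos (fun _ _ => Real.exp_pos _) Finset.univ_nonempty)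
    (Finset.sum_pos (fun _ _ => Real.exp_pos _) Finset.univ_nonempty)
  have hmain := mul_log_le_of_twoSector_eeb p p' hA hinv hinv' hB hB' β hx hy
  rw [← hxdef, ← hydef, ← hhdef, ← hrdef] at hmain
  -- `log(x/(r y)) = log(x/y) − log r`
  have hsplit : Real.log (x / (r * y)) = Real.log (x / y) - Real.log r := by
    rw [Real.log_div hx.ne' (mul_pos hr hy).ne', Real.log_mul hr.ne' hy.ne', Real.log_div hx.ne' hy.ne']
    ring
  rw [hsplit] at hmain
  have hdiv : Real.log (x / y) - Real.log r ≤ β * hh / x := by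
    rw [le_div_iff₀ hx]; linarith
  linarith

/-- **Upper bracket on the canonical chemical potential** (the same inequality read from the image
sector with the adjoint generator): `log(Z_{p'}/Z_p) ≤ log(x/y') + β·g'/y'`,
`g' = Σ_b w'_b Re⟨ψ'_b, B(ABᴴ − BᴴA)ψ'_b⟩` (`x, y' > 0`). Together with
`log_div_sub_div_le_log_partitionRatio`: the canonical chemical potential `β⁻¹ log(Z_{p'}/Z_p)` of the
charge `B` removes is pinned, up to one energy moment of each sector, by the entropic term
`β⁻¹ log(x/y')`. [cite: BratteliRobinsonII1997, §5.4.2] [cite: FawziFawziScalet2024, Thm. 3.1] -/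
theorem log_partitionRatio_le_log_div_add_div {A : Matrix ι ι ℂ} (hA : A.IsHermitian)
    (hinv : ∀ i j, ¬ p i → p j → A i j = 0) (hinv' : ∀ i j, ¬ p' i → p' j → A i j = 0)
    {B : Matrix ι ι ℂ} (hB : ∀ i j, ¬ p' i → p j → B i j = 0)
    (hB' : ∀ i j, ¬ p i → p' j → Bᴴ i j = 0) (β : ℝ)
    (hx : 0 < ∑ a, canonicalWeight β (sectorEigenvalue p A hA) a *
      (star (sectorEigenvector p A hA a) ⬝ᵥ ((Bᴴ * B) *ᵥ sectorEigenvector p A hA a)).re)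
    (hy : 0 < ∑ b, canonicalWeight β (sectorEigenvalue p' A hA) b *
      (star (sectorEigenvector p' A hA b) ⬝ᵥ ((B * Bᴴ) *ᵥ sectorEigenvector p' A hA b)).re) :
    Real.log ((∑ b, Real.exp (-(β * sectorEigenvalue p' A hA b))) /
        ∑ a, Real.exp (-(β * sectorEigenvalue p A hA a))) ≤
      Real.log ((∑ a, canonicalWeight β (sectorEigenvalue p A hA) a *
          (star (sectorEigenvector p A hA a) ⬝ᵥ ((Bᴴ * B) *ᵥ sectorEigenvector p A hA a)).re) /
        ∑ b, canonicalWeight β (sectorEigenvalue p' A hA) b *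
          (star (sectorEigenvector p' A hA b) ⬝ᵥ ((B * Bᴴ) *ᵥ sectorEigenvector p' A hA b)).re) +
      β * (∑ b, canonicalWeight β (sectorEigenvalue p' A hA) b *
          (star (sectorEigenvector p' A hA b) ⬝ᵥ ((B * (A * Bᴴ - Bᴴ * A)) *ᵥ sectorEigenvector p' A hA b)).re) /
        (∑ b, canonicalWeight β (sectorEigenvalue p' A hA) b *
          (star (sectorEigenvector p' A hA b) ⬝ᵥ ((B * Bᴴ) *ᵥ sectorEigenvector p' A hA b)).re) := by
  set x := ∑ a, canonicalWeight β (sectorEigenvalue p A hA) a *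
      (star (sectorEigenvector p A hA a) ⬝ᵥ ((Bᴴ * B) *ᵥ sectorEigenvector p A hA a)).re with hxdef
  set y := ∑ b, canonicalWeight β (sectorEigenvalue p' A hA) b *
      (star (sectorEigenvector p' A hA b) ⬝ᵥ ((B * Bᴴ) *ᵥ sectorEigenvector p' A hA b)).re with hydef
  set g := ∑ b, canonicalWeight β (sectorEigenvalue p' A hA) b *
      (star (sectorEigenvector p' A hA b) ⬝ᵥ ((B * (A * Bᴴ - Bᴴ * A)) *ᵥ sectorEigenvector p' A hA b)).re
    with hgdef
  set Z := ∑ a, Real.exp (-(β * sectorEigenvalue p A hA a)) with hZdef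
  set Z' := ∑ b, Real.exp (-(β * sectorEigenvalue p' A hA b)) with hZ'def
  have hne' : Nonempty (Subtype p') := by
    by_contra hc
    rw [not_nonempty_iff] at hc
    rw [hydef, Finset.sum_of_isEmpty] at hy
    exact lt_irrefl _ hy
  have hne : Nonempty (Subtype p) := by
    by_contra hc
    rw [not_nonempty_iff] at hc
    rw [hxdef, Finset.sum_of_isEmpty] at hx
    exact lt_irrefl _ hx
  have hZ : 0 < Z := Finset.sum_pos (fun _ _ => Real.exp_pos _) Finset.univ_nonempty
  have hZ' : 0 < Z' := Finset.sum_pos (fun _ _ => Real.exp_pos _) Finset.univ_nonempty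
  -- the two-sector inequality for `(p', p, Bᴴ)`
  have hB1 : ∀ i j, ¬ p i → p' j → Bᴴ i j = 0 := hB'
  have hB2 : ∀ i j, ¬ p' i → p j → Bᴴᴴ i j = 0 := by rw [conjTranspose_conjTranspose]; exact hB
  have hx' : 0 < ∑ b, canonicalWeight β (sectorEigenvalue p' A hA) b *
      (star (sectorEigenvector p' A hA b) ⬝ᵥ ((Bᴴᴴ * Bᴴ) *ᵥ sectorEigenvector p' A hA b)).re := by
    rw [conjTranspose_conjTranspose]; exact hy
  have hy' : 0 < ∑ a, canonicalWeight β (sectorEigenvalue p A hA) a *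
      (star (sectorEigenvector p A hA a) ⬝ᵥ ((Bᴴ * Bᴴᴴ) *ᵥ sectorEigenvector p A hA a)).re := by
    rw [conjTranspose_conjTranspose]; exact hx
  have hmain := mul_log_le_of_twoSector_eeb p' p hA hinv' hinv hB1 hB2 β hx' hy'
  simp only [conjTranspose_conjTranspose] at hmain
  rw [← hxdef, ← hydef, ← hgdef, ← hZdef, ← hZ'def] at hmain
  -- `y log(y/((Z/Z') x)) ≤ β g` ⇒ `log(Z'/Z) ≤ log(x/y) + β g / y`
  have hsplit : Real.log (y / (Z / Z' * x)) = Real.log (Z' / Z) - Real.log (x / y) := by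
    rw [Real.log_div hy.ne' (mul_pos (div_pos hZ hZ') hx).ne', Real.log_mul (div_pos hZ hZ').ne' hx.ne',
      Real.log_div hZ.ne' hZ'.ne', Real.log_div hZ'.ne' hZ.ne', Real.log_div hx.ne' hy.ne']
    ring
  rw [hsplit] at hmain
  have hdiv : Real.log (Z' / Z) - Real.log (x / y) ≤ β * g / y := by
    rw [le_div_iff₀ hy]; linarith
  linarith

end TwoSectors

end Literature.MathematicalPhysics.QuantumLattice

end
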